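import Mathlib
import HarnessLib
import Literature.MathematicalPhysics.QuantumLattice.KohnLuttingerChannelStates
import Summits.HubbardSuperconductivity.HubbardSuperconductivity.Theorems.KLProgrammeCooperVertexBlocksDefs
import Summits.HubbardSuperconductivity.HubbardSuperconductivity.Theorems.KLProgrammeCooperChannelRiccatiFlow
import Summits.HubbardSuperconductivity.HubbardSuperconductivity.Theorems.ChiralWindowCwKLChiralWindowSectorProj

/-!
# Route `KLProgramme` — D2 companion II: Schur orthogonality for `D₄` and the completeness of the block
# decomposition (the five `D₄` blocks never mix and exhaust the space)

Cell gate-hubbard-kl, seat p3 (DECOMP v7 §2 C2 «on the lattice the five `D₄` blocks are exact», App. E Lemma E.4).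
For the isotypic projections `isotypicProj ρ χ = (dim χ / 8) Σ_g χ(g) ρ_g` of `KLProgrammeCooperVertexBlocksDefs.lean`:

* `D4Irrep.char_conv` — **Schur orthogonality for `D₄` in convolution form**:
  `Σ_g χ(g) χ'(g⁻¹ u) = [χ = χ'] (8 / dim χ) χ(u)` (200 identities of integers, checked by evaluation; the diagonal
  `χ = χ'` case and `χ(g⁻¹) = χ(g)` are the tree's `kl_sp_char_conv` / `kl_sp_char_inv` of
  `ChiralWindowCwKLChiralWindowSectorProj.lean`, whose `kl_sp_d4_cases` / `kl_sp_sum_d4` bookkeeping is reused), and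
  `D4Irrep.sum_dim_mul_char` — column orthogonality at the identity `Σ_χ dim χ · χ(g) = 8 [g = 1]`;
* for a MULTIPLICATIVE action (`ρ (g h) = ρ g ρ h`): `isotypicProj_mul_isotypicProj` — `P_χ P_χ' = [χ = χ'] P_χ`
  (idempotent, pairwise orthogonal); with `ρ 1 = 1`: `sum_isotypicProj` — `Σ_χ P_χ = 1` (the five channels exhaust `E`);
  for a UNITARY action (`⟪ρ_g x, y⟫ = ⟪x, ρ_{g⁻¹} y⟫`): `inner_isotypicProj_left` — each `P_χ` is symmetric;
* consequences for a symmetric-or-not operator `A` commuting with the action: `re_inner_eq_sum_channels`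
  (`Re ⟪v, A v⟫ = Σ_χ Re ⟪P_χ v, A P_χ v⟫`), `norm_sq_eq_sum_channels` (`‖v‖² = Σ_χ ‖P_χ v‖²`), and
  **`le_formInf_of_forall_channel`**: a common lower bound of the five channel bottoms `channelFormInf ρ A χ` is a lower
  bound of `formInf A` — the operator is controlled block by block, which is how Lemma E.4 reassembles the sectorised
  `(2.71a)` bound from C2's per-block envelopes.

References: J.-P. Serre, *Linear Representations of Finite Groups*, §2.3 Thm 8 (isotypic projections); character table of
`D₄` as in `KohnLuttinger.lean` (`D4Irrep.char`).
-/

noncomputable section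

namespace Summit.HubbardSuperconductivity.HubbardSuperconductivity.Theorems.CooperVertexBlocks

set_option linter.dupNamespace false -- summit = problem name (single-conjunct summit), D-0017

open scoped InnerProductSpace
open RCLike Literature.MathematicalPhysics.QuantumLattice DihedralGroup Finset
open Summit.HubbardSuperconductivity.HubbardSuperconductivity.Theorems.CooperChannelRiccatiFlow

/-! ## Finite bookkeeping on `D₄` and its character table -/

/-- The inequalities in `ZMod 4` the character table of `E` branches on. -/
theorem zmod_four_ne : (1 : ZMod 4) ≠ 0 ∧ (1 : ZMod 4) ≠ 2 ∧ (2 : ZMod 4) ≠ 0 ∧ (3 : ZMod 4) ≠ 0 ∧ (3 : ZMod 4) ≠ 2 := by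
  decide

/-- A sum over the five irreps of `D₄`. -/
theorem sum_d4Irrep {M : Type*} [AddCommMonoid M] (f : D4Irrep → M) :
    ∑ χ, f χ = f .A1g + f .A2g + f .B1g + f .B2g + f .E := by
  let e : D4Irrep ≃ Fin 5 :=
    { toFun := fun χ => match χ with | .A1g => 0 | .A2g => 1 | .B1g => 2 | .B2g => 3 | .E => 4
      invFun := fun i => match i with | 0 => .A1g | 1 => .A2g | 2 => .B1g | 3 => .B2g | 4 => .E
      left_inv := fun χ => by cases χ <;> rfl
      right_inv := fun i => by fin_cases i <;> rfl }
  rw [Fintype.sum_equiv e f (fun i => f (e.symm i)) (fun χ => by simp), Fin.sum_univ_five]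
  rfl

namespace D4Irrep

/-- **Schur orthogonality for `D₄`, convolution form:** `Σ_g χ(g) χ'(g⁻¹ u) = [χ = χ'] · (8 / dim χ) · χ(u)`. -/
theorem char_conv (χ χ' : D4Irrep) (u : DihedralGroup 4) :
    ∑ g : DihedralGroup 4, χ.char g * χ'.char (g⁻¹ * u) =
      if χ = χ' then (8 / (χ.dim : ℝ)) * χ.char u else 0 := by
  cases χ <;> cases χ' <;>
    rcases kl_sp_d4_cases u with rfl | rfl | rfl | rfl | rfl | rfl | rfl | rfl <;>
    simp only [sum_dihedralGroup_four, inv_r, inv_sr, r_mul_r, r_mul_sr, sr_mul_r, sr_mul_sr] <;>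
    reduce_mod_char <;>
    simp only [D4Irrep.char, D4Irrep.dim, zmod_four_val.1, zmod_four_val.2.1, zmod_four_val.2.2.1,
      zmod_four_val.2.2.2, zmod_four_ne.1, zmod_four_ne.2.1, zmod_four_ne.2.2.1, zmod_four_ne.2.2.2.1,
      zmod_four_ne.2.2.2.2, if_true, if_false, reduceCtorEq] <;>
    norm_num

/-- **Column orthogonality at the identity:** `Σ_χ dim χ · χ(g) = 8 [g = 1]`. -/
theorem sum_dim_mul_char (g : DihedralGroup 4) :
    ∑ χ : D4Irrep, (χ.dim : ℝ) * χ.char g = if g = 1 then 8 else 0 := by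
  rcases kl_sp_d4_cases g with rfl | rfl | rfl | rfl | rfl | rfl | rfl | rfl <;>
    simp only [sum_d4Irrep, D4Irrep.char, D4Irrep.dim, zmod_four_val.1, zmod_four_val.2.1, zmod_four_val.2.2.1,
      zmod_four_val.2.2.2, zmod_four_ne.1, zmod_four_ne.2.1, zmod_four_ne.2.2.1, zmod_four_ne.2.2.2.1,
      zmod_four_ne.2.2.2.2, if_true, if_false, one_def, r.injEq, reduceCtorEq] <;>
    norm_num

end D4Irrep

/-! ## The isotypic projections of a multiplicative / unitary action -/

section Projections

variable {E : Type*} [NormedAddCommGroup E] [InnerProductSpace ℂ E] {ρ : DihedralGroup 4 → E →L[ℂ] E}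

/-- Group-ring bookkeeping: for a multiplicative action,
`(Σ_g a_g ρ_g)(Σ_h b_h ρ_h) = Σ_u (Σ_g a_g b_{g⁻¹u}) ρ_u`. -/
theorem sum_smul_mul_sum_smul (hρ : ∀ g h, ρ (g * h) = ρ g * ρ h) (a b : DihedralGroup 4 → ℂ) :
    (∑ g, a g • ρ g) * (∑ h, b h • ρ h) = ∑ u, (∑ g, a g * b (g⁻¹ * u)) • ρ u := by
  rw [Finset.sum_mul]
  have inner : ∀ g, (a g • ρ g) * (∑ h, b h • ρ h) = ∑ u, (a g * b (g⁻¹ * u)) • ρ u := by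
    intro g
    rw [Finset.mul_sum]
    refine Fintype.sum_equiv (Equiv.mulLeft g) _ _ fun h => ?_
    rw [Equiv.coe_mulLeft, inv_mul_cancel_left, smul_mul_assoc, mul_smul_comm, smul_smul, hρ]
  simp_rw [inner]
  rw [Finset.sum_comm]
  refine Finset.sum_congr rfl fun u _ => ?_
  rw [Finset.sum_smul]

/-- **The isotypic projections of a multiplicative `D₄`-action are orthogonal idempotents:**
`P_χ P_χ' = [χ = χ'] P_χ`. -/
theorem isotypicProj_mul_isotypicProj (hρ : ∀ g h, ρ (g * h) = ρ g * ρ h) (χ χ' : D4Irrep) :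
    isotypicProj ρ χ * isotypicProj ρ χ' = if χ = χ' then isotypicProj ρ χ else 0 := by
  have hconv : ∀ u, ∑ g, ((χ.char g : ℝ) : ℂ) * ((χ'.char (g⁻¹ * u) : ℝ) : ℂ) =
      ((if χ = χ' then (8 / (χ.dim : ℝ)) * χ.char u else 0 : ℝ) : ℂ) := by
    intro u
    rw [← D4Irrep.char_conv]
    push_cast
    rfl
  simp only [isotypicProj]
  rw [smul_mul_smul_comm, sum_smul_mul_sum_smul hρ]
  simp_rw [hconv]
  split_ifs with h
  · subst h
    have hd : (χ.dim : ℂ) ≠ 0 := by cases χ <;> simp [D4Irrep.dim]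
    simp_rw [Complex.ofReal_mul, mul_smul, ← Finset.smul_sum, smul_smul]
    congr 1
    push_cast
    field_simp
  · simp

/-- Each isotypic projection is idempotent. -/
theorem isotypicProj_idem (hρ : ∀ g h, ρ (g * h) = ρ g * ρ h) (χ : D4Irrep) :
    isotypicProj ρ χ * isotypicProj ρ χ = isotypicProj ρ χ := by
  rw [isotypicProj_mul_isotypicProj hρ, if_pos rfl]

/-- Distinct isotypic projections annihilate each other. -/
theorem isotypicProj_mul_of_ne (hρ : ∀ g h, ρ (g * h) = ρ g * ρ h) {χ χ' : D4Irrep} (h : χ ≠ χ') :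
    isotypicProj ρ χ * isotypicProj ρ χ' = 0 := by
  rw [isotypicProj_mul_isotypicProj hρ, if_neg h]

/-- **Completeness:** `Σ_χ P_χ = ρ_1`; `= 1` when `ρ_1 = 1`. -/
theorem sum_isotypicProj (h1 : ρ 1 = 1) : ∑ χ, isotypicProj ρ χ = 1 := by
  have hcol : ∀ g, ∑ χ : D4Irrep, (((χ.dim : ℂ) / 8) * ((χ.char g : ℝ) : ℂ)) =
      ((if g = 1 then 8 else 0 : ℝ) : ℂ) / 8 := by
    intro g
    rw [← D4Irrep.sum_dim_mul_char, Complex.ofReal_sum, Finset.sum_div]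
    refine Finset.sum_congr rfl fun χ _ => ?_
    push_cast
    ring
  calc ∑ χ, isotypicProj ρ χ
        = ∑ χ : D4Irrep, ∑ g : DihedralGroup 4, (((χ.dim : ℂ) / 8) * ((χ.char g : ℝ) : ℂ)) • ρ g := by
        refine Finset.sum_congr rfl fun χ _ => ?_
        rw [isotypicProj, Finset.smul_sum]
        refine Finset.sum_congr rfl fun g _ => ?_
        rw [smul_smul]
    _ = ∑ g : DihedralGroup 4, (∑ χ : D4Irrep, ((χ.dim : ℂ) / 8) * ((χ.char g : ℝ) : ℂ)) • ρ g := by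
        rw [Finset.sum_comm]
        refine Finset.sum_congr rfl fun g _ => ?_
        rw [Finset.sum_smul]
    _ = ∑ g : DihedralGroup 4, (((if g = 1 then 8 else 0 : ℝ) : ℂ) / 8) • ρ g := by simp_rw [hcol]
    _ = 1 := by
        rw [Finset.sum_eq_single (1 : DihedralGroup 4)]
        · simp [h1]
        · intro g _ hg
          simp [hg]
        · intro h
          exact absurd (Finset.mem_univ _) h

/-- Every vector is the sum of its channel components. -/
theorem sum_isotypicProj_apply (h1 : ρ 1 = 1) (v : E) : ∑ χ, isotypicProj ρ χ v = v := by
  have h := congrArg (fun S : E →L[ℂ] E => S v) (sum_isotypicProj (ρ := ρ) h1)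
  simp only [_root_.sum_apply] at h
  exact h

/-- **The isotypic projections of a unitary action are symmetric:** `⟪P_χ x, y⟫ = ⟪x, P_χ y⟫`. -/
theorem inner_isotypicProj_left (hadj : ∀ g (x y : E), ⟪ρ g x, y⟫_ℂ = ⟪x, ρ g⁻¹ y⟫_ℂ) (χ : D4Irrep)
    (x y : E) : ⟪isotypicProj ρ χ x, y⟫_ℂ = ⟪x, isotypicProj ρ χ y⟫_ℂ := by
  have hcoef : (starRingEnd ℂ) ((χ.dim : ℂ) / 8) = (χ.dim : ℂ) / 8 := by
    rw [map_div₀, map_natCast, map_ofNat]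
  have hx : isotypicProj ρ χ x = ((χ.dim : ℂ) / 8) • ∑ g, ((χ.char g : ℝ) : ℂ) • ρ g x := by
    simp only [isotypicProj, _root_.smul_apply, _root_.sum_apply]
  have hy : isotypicProj ρ χ y = ((χ.dim : ℂ) / 8) • ∑ g, ((χ.char g : ℝ) : ℂ) • ρ g y := by
    simp only [isotypicProj, _root_.smul_apply, _root_.sum_apply]
  rw [hx, hy, inner_smul_left, inner_smul_right, hcoef, sum_inner, inner_sum]
  congr 1
  refine Fintype.sum_equiv (Equiv.inv (DihedralGroup 4)) _ _ fun g => ?_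
  rw [Equiv.inv_apply, inner_smul_left, inner_smul_right, Complex.conj_ofReal, hadj, kl_sp_char_inv]

/-- Channel components of distinct channels are orthogonal (unitary multiplicative action). -/
theorem inner_isotypicProj_isotypicProj_of_ne (hρ : ∀ g h, ρ (g * h) = ρ g * ρ h)
    (hadj : ∀ g (x y : E), ⟪ρ g x, y⟫_ℂ = ⟪x, ρ g⁻¹ y⟫_ℂ) {χ χ' : D4Irrep} (h : χ ≠ χ') (x y : E) :
    ⟪isotypicProj ρ χ x, isotypicProj ρ χ' y⟫_ℂ = 0 := by
  rw [← inner_isotypicProj_left hadj]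
  change ⟪(isotypicProj ρ χ' * isotypicProj ρ χ) x, y⟫_ℂ = 0
  rw [isotypicProj_mul_of_ne hρ (Ne.symm h)]
  simp

/-- **Pythagoras over the channels:** `‖v‖² = Σ_χ ‖P_χ v‖²`. -/
theorem norm_sq_eq_sum_channels (hρ : ∀ g h, ρ (g * h) = ρ g * ρ h) (h1 : ρ 1 = 1)
    (hadj : ∀ g (x y : E), ⟪ρ g x, y⟫_ℂ = ⟪x, ρ g⁻¹ y⟫_ℂ) (v : E) :
    ‖v‖ ^ 2 = ∑ χ, ‖isotypicProj ρ χ v‖ ^ 2 := by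
  have hv := sum_isotypicProj_apply (ρ := ρ) h1 v
  have hPP : ∀ χ (w : E), isotypicProj ρ χ (isotypicProj ρ χ w) = isotypicProj ρ χ w := fun χ w => by
    have h := congrArg (fun S : E →L[ℂ] E => S w) (isotypicProj_idem hρ χ)
    exact h
  rw [@norm_sq_eq_re_inner ℂ]
  calc re ⟪v, v⟫_ℂ = re ⟪∑ χ, isotypicProj ρ χ v, v⟫_ℂ := by rw [hv]
    _ = ∑ χ, re ⟪isotypicProj ρ χ v, v⟫_ℂ := by rw [sum_inner, map_sum]
    _ = ∑ χ, ‖isotypicProj ρ χ v‖ ^ 2 := by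
        refine Finset.sum_congr rfl fun χ _ => ?_
        rw [@norm_sq_eq_re_inner ℂ, ← inner_isotypicProj_left hadj χ (isotypicProj ρ χ v) v, hPP]

/-- **The form of an operator commuting with the action splits over the channels:**
`Re ⟪v, A v⟫ = Σ_χ Re ⟪P_χ v, A (P_χ v)⟫`. -/
theorem re_inner_eq_sum_channels (hρ : ∀ g h, ρ (g * h) = ρ g * ρ h) (h1 : ρ 1 = 1)
    (hadj : ∀ g (x y : E), ⟪ρ g x, y⟫_ℂ = ⟪x, ρ g⁻¹ y⟫_ℂ) {A : E →L[ℂ] E} (hA : ∀ g, A * ρ g = ρ g * A) (v : E) :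
    re ⟪v, A v⟫_ℂ = ∑ χ, re ⟪isotypicProj ρ χ v, A (isotypicProj ρ χ v)⟫_ℂ := by
  have hv := sum_isotypicProj_apply (ρ := ρ) h1 v
  have hcomm : ∀ χ (w : E), A (isotypicProj ρ χ w) = isotypicProj ρ χ (A w) := fun χ w => by
    have h := congrArg (fun S : E →L[ℂ] E => S w) (isotypicProj_comm hA χ)
    exact h
  have hPP : ∀ χ (w : E), isotypicProj ρ χ (isotypicProj ρ χ w) = isotypicProj ρ χ w := fun χ w => by
    have h := congrArg (fun S : E →L[ℂ] E => S w) (isotypicProj_idem hρ χ)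
    exact h
  calc re ⟪v, A v⟫_ℂ = re ⟪∑ χ, isotypicProj ρ χ v, A v⟫_ℂ := by rw [hv]
    _ = ∑ χ, re ⟪isotypicProj ρ χ v, A v⟫_ℂ := by rw [sum_inner, map_sum]
    _ = ∑ χ, re ⟪isotypicProj ρ χ v, A (isotypicProj ρ χ v)⟫_ℂ := by
        refine Finset.sum_congr rfl fun χ _ => ?_
        rw [hcomm χ v, ← inner_isotypicProj_left hadj χ (isotypicProj ρ χ v) (A v), hPP]
where
  /-- (local restatement to keep this file independent of the companion file's import order)
  an operator commuting with the action commutes with every isotypic projection -/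
  isotypicProj_comm {A : E →L[ℂ] E} (hA : ∀ g, A * ρ g = ρ g * A) (χ : D4Irrep) :
      A * isotypicProj ρ χ = isotypicProj ρ χ * A := by
    simp only [isotypicProj, mul_smul_comm, smul_mul_assoc, Finset.mul_sum, Finset.sum_mul, hA]

/-- **A common lower bound of the channel bottoms bounds the whole form from below:** if the action is a unitary
representation, `A` commutes with it and `c ≤ Re ⟪w, A w⟫` for every unit vector `w` of every channel (vacuous on an
empty channel), then `c ≤ formInf A`.  With the upper bound `formInf A ≤ channelFormInf ρ A χ` on nonempty channels this is
«`formInf A = min_χ` channel bottom»: the operator is controlled block by block. -/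
theorem le_formInf_of_forall_channel [Nontrivial E] (hρ : ∀ g h, ρ (g * h) = ρ g * ρ h) (h1 : ρ 1 = 1)
    (hadj : ∀ g (x y : E), ⟪ρ g x, y⟫_ℂ = ⟪x, ρ g⁻¹ y⟫_ℂ) {A : E →L[ℂ] E} (hA : ∀ g, A * ρ g = ρ g * A) {c : ℝ}
    (hc : ∀ χ (w : E), ‖w‖ = 1 → isotypicProj ρ χ w = w → c ≤ re ⟪w, A w⟫_ℂ) :
    c ≤ formInf A := by
  refine le_formInf A fun v hv => ?_
  rw [re_inner_eq_sum_channels hρ h1 hadj hA v]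
  have hsq := norm_sq_eq_sum_channels hρ h1 hadj v
  rw [hv, one_pow] at hsq
  -- each channel term is ≥ c ‖P_χ v‖²
  have hterm : ∀ χ, c * ‖isotypicProj ρ χ v‖ ^ 2 ≤ re ⟪isotypicProj ρ χ v, A (isotypicProj ρ χ v)⟫_ℂ := by
    intro χ
    set w := isotypicProj ρ χ v with hw
    by_cases hw0 : w = 0
    · simp [hw0]
    · have hfix : isotypicProj ρ χ w = w := by
        have h := congrArg (fun S : E →L[ℂ] E => S v) (isotypicProj_idem hρ χ)
        exact h
      set u : E := ((‖w‖ : ℂ)⁻¹) • w with hu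
      have hun : ‖u‖ = 1 := norm_normalize hw0
      have hufix : isotypicProj ρ χ u = u := by rw [hu, map_smul, hfix]
      have h := hc χ u hun hufix
      rw [hu, re_inner_normalize A w] at h
      have hpos : 0 < ‖w‖ ^ 2 := by positivity
      have := mul_le_mul_of_nonneg_left h hpos.le
      calc c * ‖w‖ ^ 2 = ‖w‖ ^ 2 * c := by ring
        _ ≤ ‖w‖ ^ 2 * (‖w‖⁻¹ ^ 2 * re ⟪w, A w⟫_ℂ) := this
        _ = re ⟪w, A w⟫_ℂ := by field_simp
  calc c = c * ∑ χ, ‖isotypicProj ρ χ v‖ ^ 2 := by rw [← hsq, mul_one]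
    _ = ∑ χ, c * ‖isotypicProj ρ χ v‖ ^ 2 := by rw [Finset.mul_sum]
    _ ≤ ∑ χ, re ⟪isotypicProj ρ χ v, A (isotypicProj ρ χ v)⟫_ℂ := Finset.sum_le_sum fun χ _ => hterm χ

/-- The whole form's bottom is below every nonempty channel's bottom: `formInf A ≤ channelFormInf ρ A χ` whenever the
channel contains a unit vector. -/
theorem formInf_le_channelFormInf (A : E →L[ℂ] E) {χ : D4Irrep} (hne : ∃ w : E, ‖w‖ = 1 ∧ isotypicProj ρ χ w = w) :
    formInf A ≤ channelFormInf ρ A χ := by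
  obtain ⟨w₀, hw₀, hw₀'⟩ := hne
  refine le_csInf ⟨_, w₀, ⟨hw₀, hw₀'⟩, rfl⟩ ?_
  rintro _ ⟨w, ⟨hw, -⟩, rfl⟩
  exact formInf_le A hw

end Projections

end Summit.HubbardSuperconductivity.HubbardSuperconductivity.Theorems.CooperVertexBlocks

end
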